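import Mathlib
import HarnessLib

/-!
# Laguerre's Newton disc: a zero in the disc with diameter `[z₀, z₀ + n h₀]` (Henrici Thm 6.5d)

Topic: Analysis / Complex (`Literature/Analysis/Complex/`).

Let `p ∈ ℂ[X]` have degree `n ≥ 1`, let `z₀ ∈ ℂ` with `p'(z₀) ≠ 0`, and let
`h₀ := -p(z₀)/p'(z₀)` be the **Newton correction** at `z₀`. Corollary 6.4g of
[Henrici1974, §6.4] (tree: `Literature.Algebra.Polynomial.NearestZeroBounds`) places a zero of `p`
in the disc `|z - z₀| ≤ n |h₀|`. Laguerre's theorem sharpens this "in a very elegant manner"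
[Henrici1974, §6.5 Thm 6.5b, Cor 6.5c]: **Theorem 6.5d** — *any circular region with the points
`z₀` and `z₀ + n h₀` on its boundary contains at least one zero of `p`; in particular the
closed disc with the segment from `z₀` to `z₀ + n h₀` as a diameter does.*

This file gives a short direct proof over `ℂ` (instead of Henrici's route through Laguerre's
theorem 6.5b on polar derivatives and circular regions): if `p(z₀) = 0` the point `z₀` itself is
a zero on the boundary of every such region; otherwise, with `a := n h₀ / 2 ≠ 0` and the zeros
`w₁, …, wₙ` of `p`, the logarithmic derivative `p'/p (z₀) = Σ 1/(z₀ - w_k)`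
(`Polynomial.Splits.eval_derivative_div_eval_of_ne_zero`) gives the exact mean value

  `(1/n) Σ_k a / (w_k - z₀) = 1/2`                                  (`sum_roots_div_sub_eq`),

so for every direction `e ∈ ℂ` some zero satisfies `Re (e · a/(w_k - z₀)) ≥ Re e / 2`
(`exists_root_half_re_le`). Under the inversion `w ↦ a/(w - z₀)` the circular regions with `z₀`
and `z₀ + n h₀ = z₀ + 2a` on their boundary are exactly the closed half-planes whose boundary
line passes through the point `1/2`, whence Theorem 6.5d; spelled out:

* `exists_root_norm_sub_le` — the closed **Newton disc** `|w - (z₀ + a)| ≤ |a|` (diameter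
  `[z₀, z₀ + n h₀]`) contains a zero (`e = 1`; `norm_sub_le_norm_iff` is the inversion
  dictionary `|v - a| ≤ |a| ↔ Re (a/v) ≥ 1/2`);
* `exists_root_norm_le_norm_sub` — so does its closed EXTERIOR (`e = -1`): the zeros are never
  all strictly inside the Newton disc;
* `exists_root_im_div_nonneg`, `exists_root_im_div_nonpos` — each closed half-plane bounded by
  the Newton line through `z₀` in the direction `h₀` contains a zero (`e = ∓I`).

Conventions. `p : ℂ[X]` (so `p` splits, `IsAlgClosed.splits p`); zeros are the members of the
multiset `p.roots`; `n = p.natDegree`; `a = -(n p(z₀)) / (2 p'(z₀))` and `h₀` are written out in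
each statement (no auxiliary definition). The mean-value identities need `p(z₀) ≠ 0 ≠ p'(z₀)`;
the four region statements only `p'(z₀) ≠ 0` and `deg p ≥ 1`, exactly as in Henrici's
Theorem 6.5d. Not formalised: Laguerre's theorem 6.5b itself (polar
derivative `D_c p = n p - (z - c) p'`, arbitrary circular regions), Cor 6.5c, Grace's theorem
6.5g.
-/

noncomputable section

open Polynomial Complex

namespace Literature.Analysis.Complex.LaguerreNewtonDisc

variable {p : ℂ[X]} {z₀ : ℂ}

/-! ## The mean value of `a / (w - z₀)` over the zeros -/

/-- `Σ_{w ∈ roots p} (w - z₀)⁻¹ = -p'(z₀)/p(z₀)` for `p(z₀) ≠ 0` (the logarithmic derivative,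
Mathlib `Polynomial.Splits.eval_derivative_div_eval_of_ne_zero`, with the sign of `w - z₀`).
[folklore] -/
private theorem sum_roots_inv_sub_eq (h0 : p.eval z₀ ≠ 0) :
    (p.roots.map fun w => (w - z₀)⁻¹).sum = -(p.derivative.eval z₀ / p.eval z₀) := by
  rw [(IsAlgClosed.splits p).eval_derivative_div_eval_of_ne_zero h0, ← Multiset.sum_map_neg]
  congr 1
  refine Multiset.map_congr rfl fun w _ => ?_
  rw [one_div, ← inv_neg, neg_sub]

/-- **The exact mean value.** With `a := -n p(z₀) / (2 p'(z₀))` (half the `n`-fold Newton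
correction), `Σ_{w ∈ roots p} a / (w - z₀) = n / 2` whenever `p(z₀) ≠ 0 ≠ p'(z₀)`.
[cite: Henrici1974, §6.5 Thm 6.5d] -/
theorem sum_roots_div_sub_eq (h0 : p.eval z₀ ≠ 0) (h1 : p.derivative.eval z₀ ≠ 0) :
    (p.roots.map fun w =>
      -(p.natDegree * p.eval z₀ / (2 * p.derivative.eval z₀)) / (w - z₀)).sum =
        p.natDegree / 2 := by
  simp_rw [div_eq_mul_inv _ (_ - z₀)]
  rw [Multiset.sum_map_mul_left, sum_roots_inv_sub_eq h0]
  field_simp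

/-- **Laguerre's theorem for the Newton step, mean-value form** (Henrici Thm 6.5d): for every
direction `e ∈ ℂ` some zero `w` of `p` (`deg p ≥ 1`, `p(z₀) ≠ 0 ≠ p'(z₀)`) satisfies
`Re e / 2 ≤ Re (e · a / (w - z₀))`, `a = -n p(z₀)/(2 p'(z₀))` — i.e. every closed half-plane
(in the variable `a/(w - z₀)`) whose boundary passes through `1/2` contains the image of a zero;
these are the circular regions with `z₀` and `z₀ + 2a` on their boundary.
[cite: Henrici1974, §6.5 Thm 6.5d] -/
theorem exists_root_half_re_le (hn : 0 < p.natDegree) (h0 : p.eval z₀ ≠ 0)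
    (h1 : p.derivative.eval z₀ ≠ 0) (e : ℂ) :
    ∃ w ∈ p.roots, e.re / 2 ≤
      (e * (-(p.natDegree * p.eval z₀ / (2 * p.derivative.eval z₀)) / (w - z₀))).re := by
  by_contra hcon
  push Not at hcon
  have hne : p.roots ≠ 0 := by
    intro h
    rw [(IsAlgClosed.splits p).natDegree_eq_card_roots, h, Multiset.card_zero] at hn
    exact lt_irrefl 0 hn
  have hlt := Multiset.sum_lt_sum_of_nonempty hne hcon
  have hre : (p.roots.map fun w => (e * (-(p.natDegree * p.eval z₀ /
      (2 * p.derivative.eval z₀)) / (w - z₀))).re).sum = p.natDegree * (e.re / 2) := by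
    have h := congrArg (fun s : ℂ => (e * s).re)
      (sum_roots_div_sub_eq (p := p) (z₀ := z₀) h0 h1)
    rw [← Multiset.sum_map_mul_left, ← Complex.coe_reAddGroupHom, map_multiset_sum,
      Multiset.map_map] at h
    rw [Function.comp_def, Complex.coe_reAddGroupHom] at h
    rw [h]
    have h2 : (e * (p.natDegree / 2 : ℂ)).re = e.re * (p.natDegree / 2) := by
      rw [show (p.natDegree / 2 : ℂ) = ((p.natDegree / 2 : ℝ) : ℂ) by push_cast; ring,
        Complex.re_mul_ofReal]
    rw [h2]
    ring
  rw [hre, Multiset.map_const', Multiset.sum_replicate, nsmul_eq_mul,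
    ← (IsAlgClosed.splits p).natDegree_eq_card_roots] at hlt
  exact lt_irrefl _ hlt

/-! ## The inversion dictionary and Theorem 6.5d -/

/-- Discs through the origin are half-planes after inversion: for `v ≠ 0`,
`|v - a| ≤ |a| ↔ 1/2 ≤ Re (a / v)`. [folklore] -/
private theorem norm_sub_le_norm_iff {v a : ℂ} (hv : v ≠ 0) : ‖v - a‖ ≤ ‖a‖ ↔ 1 / 2 ≤ (a / v).re := by
  have hN : 0 < normSq v := normSq_pos.mpr hv
  rw [← sq_le_sq₀ (norm_nonneg _) (norm_nonneg _), ← normSq_eq_norm_sq, ← normSq_eq_norm_sq,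
    Complex.div_re, ← add_div, le_div_iff₀ hN]
  simp only [normSq_apply, sub_re, sub_im]
  constructor <;> intro h <;> nlinarith

/-- The complementary dictionary: `|a| ≤ |v - a| ↔ Re (a / v) ≤ 1/2` (`v ≠ 0`). [folklore] -/
private theorem norm_le_norm_sub_iff {v a : ℂ} (hv : v ≠ 0) : ‖a‖ ≤ ‖v - a‖ ↔ (a / v).re ≤ 1 / 2 := by
  have hN : 0 < normSq v := normSq_pos.mpr hv
  rw [← sq_le_sq₀ (norm_nonneg _) (norm_nonneg _), ← normSq_eq_norm_sq, ← normSq_eq_norm_sq,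
    Complex.div_re, ← add_div, div_le_iff₀ hN]
  simp only [normSq_apply, sub_re, sub_im]
  constructor <;> intro h <;> nlinarith

/-- A zero of `p` is not `z₀` when `p(z₀) ≠ 0`. [folklore] -/
private theorem sub_ne_zero_of_mem_roots (h0 : p.eval z₀ ≠ 0) {w : ℂ} (hw : w ∈ p.roots) : w - z₀ ≠ 0 := by
  intro h
  rw [sub_eq_zero] at h
  rw [h] at hw
  exact h0 ((mem_roots'.mp hw).2)

/-- **Theorem 6.5d (Laguerre–Henrici), the Newton disc.** If `deg p = n ≥ 1` and
`p'(z₀) ≠ 0`, the closed disc with the segment from `z₀` to `z₀ + n h₀`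
(`h₀ = -p(z₀)/p'(z₀)` the Newton correction) as a diameter — centre `z₀ + a`, radius `|a|`,
`a = -n p(z₀)/(2 p'(z₀))` — contains at least one zero of `p` (for `p(z₀) = 0` the disc is the
point `z₀`, itself a zero). This disc lies inside the disc `|z - z₀| ≤ n |h₀|` of Cor 6.4g.
[cite: Henrici1974, §6.5 Thm 6.5d] -/
theorem exists_root_norm_sub_le (hn : 0 < p.natDegree) (h1 : p.derivative.eval z₀ ≠ 0) :
    ∃ w ∈ p.roots, ‖w - (z₀ + -(p.natDegree * p.eval z₀ / (2 * p.derivative.eval z₀)))‖ ≤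
      ‖-(p.natDegree * p.eval z₀ / (2 * p.derivative.eval z₀))‖ := by
  by_cases h0 : p.eval z₀ = 0
  · exact ⟨z₀, mem_roots'.mpr ⟨ne_zero_of_natDegree_gt hn, h0⟩, by simp [h0]⟩
  obtain ⟨w, hw, hle⟩ := exists_root_half_re_le hn h0 h1 1
  refine ⟨w, hw, ?_⟩
  rw [one_re, one_mul] at hle
  rw [← sub_sub, norm_sub_le_norm_iff (sub_ne_zero_of_mem_roots h0 hw)]
  exact hle

/-- **Theorem 6.5d, exterior region.** Under the same hypotheses the closed EXTERIOR of the
Newton disc, `|a| ≤ |w - (z₀ + a)|`, also contains a zero of `p` (the complementary circular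
region has the same two boundary points): the zeros never all lie strictly inside the Newton
disc. [cite: Henrici1974, §6.5 Thm 6.5d] -/
theorem exists_root_norm_le_norm_sub (hn : 0 < p.natDegree) (h1 : p.derivative.eval z₀ ≠ 0) :
    ∃ w ∈ p.roots, ‖-(p.natDegree * p.eval z₀ / (2 * p.derivative.eval z₀))‖ ≤
      ‖w - (z₀ + -(p.natDegree * p.eval z₀ / (2 * p.derivative.eval z₀)))‖ := by
  by_cases h0 : p.eval z₀ = 0
  · exact ⟨z₀, mem_roots'.mpr ⟨ne_zero_of_natDegree_gt hn, h0⟩, by simp [h0]⟩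
  obtain ⟨w, hw, hle⟩ := exists_root_half_re_le hn h0 h1 (-1)
  refine ⟨w, hw, ?_⟩
  rw [neg_re, one_re, neg_one_mul, neg_re, neg_div, neg_le_neg_iff] at hle
  rw [← sub_sub, norm_le_norm_sub_iff (sub_ne_zero_of_mem_roots h0 hw)]
  exact hle

/-- **Theorem 6.5d, half-planes.** Each closed half-plane bounded by the Newton line (through
`z₀` in the direction of `h₀ = -p(z₀)/p'(z₀)`) contains a zero: some zero has
`Im ((w - z₀)/h₀) ≥ 0` … [cite: Henrici1974, §6.5 Thm 6.5d] -/
theorem exists_root_im_div_nonneg (hn : 0 < p.natDegree) (h1 : p.derivative.eval z₀ ≠ 0) :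
    ∃ w ∈ p.roots, 0 ≤ ((w - z₀) / -(p.eval z₀ / p.derivative.eval z₀)).im := by
  by_cases h0 : p.eval z₀ = 0
  · exact ⟨z₀, mem_roots'.mpr ⟨ne_zero_of_natDegree_gt hn, h0⟩, by simp [h0]⟩
  obtain ⟨w, hw, hle⟩ := exists_root_half_re_le hn h0 h1 I
  refine ⟨w, hw, ?_⟩
  have hv : w - z₀ ≠ 0 := sub_ne_zero_of_mem_roots h0 hw
  rw [I_re, zero_div, I_mul_re, neg_nonneg] at hle
  -- `Im (a / v) ≤ 0` with `a = (n/2) · h₀`, and `Im (v / h₀) = -Im (h₀ / v) · |v/h₀|²`-type sign flip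
  have hh : -(p.eval z₀ / p.derivative.eval z₀) ≠ 0 := by
    rw [neg_ne_zero, div_ne_zero_iff]; exact ⟨h0, h1⟩
  have hn' : (0 : ℝ) < p.natDegree := by exact_mod_cast hn
  have key : (-(p.natDegree * p.eval z₀ / (2 * p.derivative.eval z₀)) / (w - z₀)) =
      ((p.natDegree / 2 : ℝ) : ℂ) * ((w - z₀) / -(p.eval z₀ / p.derivative.eval z₀))⁻¹ := by
    push_cast
    field_simp
  rw [key, Complex.im_ofReal_mul] at hle
  have him : ((w - z₀) / -(p.eval z₀ / p.derivative.eval z₀))⁻¹.im ≤ 0 := by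
    by_contra hc
    push Not at hc
    have := mul_pos (by positivity : (0 : ℝ) < p.natDegree / 2) hc
    linarith
  rw [inv_im, div_le_iff₀ (normSq_pos.mpr (div_ne_zero hv hh)), zero_mul, neg_nonpos] at him
  exact him

/-- … and some zero has `Im ((w - z₀)/h₀) ≤ 0`. [cite: Henrici1974, §6.5 Thm 6.5d] -/
theorem exists_root_im_div_nonpos (hn : 0 < p.natDegree) (h1 : p.derivative.eval z₀ ≠ 0) :
    ∃ w ∈ p.roots, ((w - z₀) / -(p.eval z₀ / p.derivative.eval z₀)).im ≤ 0 := by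
  by_cases h0 : p.eval z₀ = 0
  · exact ⟨z₀, mem_roots'.mpr ⟨ne_zero_of_natDegree_gt hn, h0⟩, by simp [h0]⟩
  obtain ⟨w, hw, hle⟩ := exists_root_half_re_le hn h0 h1 (-I)
  refine ⟨w, hw, ?_⟩
  have hv : w - z₀ ≠ 0 := sub_ne_zero_of_mem_roots h0 hw
  rw [neg_re, I_re, neg_zero, zero_div, neg_mul, neg_re, I_mul_re, neg_neg] at hle
  have hh : -(p.eval z₀ / p.derivative.eval z₀) ≠ 0 := by
    rw [neg_ne_zero, div_ne_zero_iff]; exact ⟨h0, h1⟩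
  have hn' : (0 : ℝ) < p.natDegree := by exact_mod_cast hn
  have key : (-(p.natDegree * p.eval z₀ / (2 * p.derivative.eval z₀)) / (w - z₀)) =
      ((p.natDegree / 2 : ℝ) : ℂ) * ((w - z₀) / -(p.eval z₀ / p.derivative.eval z₀))⁻¹ := by
    push_cast
    field_simp
  rw [key, Complex.im_ofReal_mul] at hle
  have him : 0 ≤ ((w - z₀) / -(p.eval z₀ / p.derivative.eval z₀))⁻¹.im := by
    by_contra hc
    push Not at hc
    have := mul_neg_of_pos_of_neg (by positivity : (0 : ℝ) < p.natDegree / 2) hc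
    linarith
  rw [inv_im, le_div_iff₀ (normSq_pos.mpr (div_ne_zero hv hh)), zero_mul, neg_nonneg] at him
  exact him

end Literature.Analysis.Complex.LaguerreNewtonDisc

end
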